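import Literature.Barriers.CriticalPhenomena.RigorousRGSmallParameterCovarianceBound
import HarnessLib

/-!
# `RigorousRGSmallParameter` (Slade, Theorem 1.4.1): the covariance decomposition
# `((-Δ_{ℤ^d})^{α/2}+m²)⁻¹ = Σ_j C_j` of the fractional Laplacian on `ℤ^d` (Slade (3.7)–(3.8),
# [Mitt16]), obtained by inserting `Γ = Σ_jΓ_j(s)` into the Kato mixture (3.6)

Companion of `RigorousRGSmallParameterCovarianceBound.lean` (`FRD.fracCov` = `C_j` of (3.8) and
the scaling estimate (3.9)) in the proof architecture of the barrier `RigorousRGSmallParameter.lean`.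
Source: G. Slade, *Critical exponents for long-range `O(n)` models below the upper critical
dimension*, Commun. Math. Phys. 358 (2018) 343–436, §3.2: "By (2.16), `C_{0,x} =
∫₀^∞ (-Δ_Λ+s)⁻¹_{0x} ρ^{(α/2)}(s,m²) ds` (3.6). As in [Mitt16], we obtain a finite-range
positive-definite covariance decomposition by inserting (3.5) into (3.6), namely (3.7)
`((-Δ_Λ)^{α/2}+m²)⁻¹ = Σ_{j=1}^{N-1} C_j + C_{N,N}`, with (3.8) `C_{j;0,x} =
∫₀^∞ Γ_{j;0,x}(s) ρ^{(α/2)}(s,m²) ds` … This is valid whenever we have a decomposition for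
strictly positive `s > 0`, i.e., for all `d ≥ 1`. Again it is the case that `C_j` serves as a
term in the decomposition of the `ℤ^d` covariance as well as in the torus covariance when
`j < N`". Here: the `ℤ^d` statement `((-Δ_{ℤ^d})^{α/2}+m²)⁻¹_{0,x} = Σ_{j≥1} C_{j;0,x}` for
`m² > 0`, for the explicit [Baue13a]/BBS decomposition; the interchange of `Σ_j` and `∫ds`
("inserting") is justified by dominated convergence with the dominating function
`(-Δ+s)⁻¹_{0,0} ρ(s,m²) ≤ s⁻¹ρ(s,m²)` (from `|w(t,x)| ≤ w(t,0)`).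

## What this file proves (everything; no definition and no named fact is introduced)

* `FRD.measurable_wHat₃`, `FRD.measurable_wKer₂`, **`FRD.measurable_Gam`** — joint
  measurability of `(s,t,k) ↦ ŵ`, of `(s,t) ↦ w(t,x;s)` and measurability of `s ↦ Γ_j(x)(s)`
  (series of continuous functions; parametric integrals).
* `FRD.wKer_zero_nonneg`, `FRD.Gam_zero_nonneg`, **`FRD.abs_Gam_le_Gam_zero`**
  (`|Γ_{j;0,x}(s)| ≤ Γ_{j;0,0}(s)`, from `|w(t,x)| ≤ w(t,0)`), `FRD.Gam_zero_le_inv`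
  (`Γ_{j;0,0}(s) ≤ (-Δ+s)⁻¹_{0,0} ≤ s⁻¹`).
* `FRD.integrableOn_inv_mul_katoDensity` (`s⁻¹ρ(s,m²)` is integrable on `(0,∞)` for `m² > 0`),
  **`FRD.integrableOn_Gam_mul_katoDensity`** — the integrand `Γ_{j;0,x}(s)ρ^{(α/2)}(s,m²)` of
  (3.8) is integrable on `(0,∞)` (`m² > 0`), so that `C_j = FRD.fracCov` is a genuine integral.
* `FRD.integrableOn_rpow_neg_div`, `FRD.continuous_katoDensity_mass`,
  **`FRD.continuous_fracCov_mass`** — **Proposition 3.3.1, "`C_{j;x,y}` is continuous in `m²`",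
  PROVED** (dominated convergence; scaling estimate at `p = 0` and `ρ(s,a) ≤ s^{-β}/(π sin πβ)`).
* **`FRD.hasSum_fracCov`**, **`FRD.Slade2017_display37_Zd`** — **Slade (3.7) on `ℤ^d`, PROVED**:
  `Σ_{j≥1} C_{j;0,x}(m²) = ∫₀^∞ (-Δ+s)⁻¹_{x,0} ρ^{(α/2)}(s,m²) ds = ((-Δ_{ℤ^d})^{α/2}+m²)⁻¹_{x,0}`
  for `d ≥ 1`, `α ∈ (0,2)`, `m² > 0`, `L > 1` (the last equality is Proposition 2.1.3,
  `Slade2017_prop213_resolvent`).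

Not treated: the torus version with `C_{N,N}` ((3.4)–(3.5), (3.7) on `Λ_N`), `m² = 0`.
-/

noncomputable section

namespace Literature.Barriers.CriticalPhenomena

open _root_.MeasureTheory Set Filter
open scoped _root_.Topology Real

namespace LongRangePhi4

namespace FRD

open Literature.Probability.LatticeModels

variable {d : ℕ}

/-! ### Measurability in the mass parameter `s` -/

/-- Joint measurability of `(s,t,k) ↦ ŵ(t,k;s)`. [folklore] -/
theorem measurable_wHat₃ :
    Measurable fun p : ℝ × ℝ × (Fin d → ℝ) => wHat d p.1 p.2.1 p.2.2 := by
  unfold wHat chebyProfile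
  have hcont : Continuous fun v : ℝ => (profile v).re := Complex.continuous_re.comp profile.continuous
  have hP := measurable_periodicProfile hcont
  have hlc : Continuous (laplaceSymbol : (Fin d → ℝ) → ℝ) :=
    continuous_const.mul (continuous_dispersion d)
  have hl : Measurable fun p : ℝ × ℝ × (Fin d → ℝ) => laplaceSymbol p.2.2 :=
    hlc.measurable.comp (measurable_snd.comp measurable_snd)
  have hs : Measurable fun p : ℝ × ℝ × (Fin d → ℝ) => p.1 := measurable_fst
  have hM : Measurable fun p : ℝ × ℝ × (Fin d → ℝ) => 2 * (d : ℝ) + p.1 := measurable_fst.const_add _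
  have hζ : Measurable fun p : ℝ × ℝ × (Fin d → ℝ) =>
      Real.arccos (1 - (laplaceSymbol p.2.2 + p.1) / (2 * d + p.1) / 2) :=
    Real.continuous_arccos.measurable.comp ((((hl.add hs).div hM).div_const _).const_sub 1)
  have ht : Measurable fun p : ℝ × ℝ × (Fin d → ℝ) => p.2.1 := measurable_fst.comp measurable_snd
  have hθ : Measurable fun p : ℝ × ℝ × (Fin d → ℝ) =>
      (p.2.1, Real.arccos (1 - (laplaceSymbol p.2.2 + p.1) / (2 * d + p.1) / 2)) := ht.prodMk hζ
  -- (elaborated without expected type, as in `measurable_wHat`)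
  have h2 := hP.comp hθ
  have h1 : Measurable fun p : ℝ × ℝ × (Fin d → ℝ) => p.2.1 ^ 2 / (cProfile * (2 * d + p.1)) :=
    (ht.pow_const 2).div (hM.const_mul cProfile)
  exact Measurable.mul h1 h2

/-- Joint measurability of `(s,t) ↦ w(t,x;s)` (a parametric integral over the Brillouin zone).
[folklore] -/
theorem measurable_wKer₂ (x : Site d) : Measurable fun p : ℝ × ℝ => wKer d p.1 p.2 x := by
  have h1 : Measurable fun q : (ℝ × ℝ) × (Fin d → ℝ) => wHat d q.1.1 q.1.2 q.2 :=
    measurable_wHat₃.comp ((measurable_fst.comp measurable_fst).prodMk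
      ((measurable_snd.comp measurable_fst).prodMk measurable_snd))
  have hm : Measurable fun q : (ℝ × ℝ) × (Fin d → ℝ) =>
      wHat d q.1.1 q.1.2 q.2 * Real.cos (phase q.2 x) :=
    h1.mul (Real.continuous_cos.measurable.comp ((continuous_phase x).measurable.comp measurable_snd))
  have h := (hm.stronglyMeasurable.integral_prod_right'
    (ν := (volume : Measure (Fin d → ℝ)).restrict (brillouin d))).measurable
  unfold wKer
  exact h.const_mul _

/-- **Measurability of `s ↦ Γ_{j;0,x}(s)`** (a parametric integral over the scale interval).
[folklore] -/
theorem measurable_Gam (L : ℝ) (j : ℕ) (x : Site d) : Measurable fun s : ℝ => Gam d L s j x := by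
  have hm : Measurable fun q : ℝ × ℝ => wKer d q.1 q.2 x / q.2 :=
    (measurable_wKer₂ x).div measurable_snd
  have h := (hm.stronglyMeasurable.integral_prod_right'
    (ν := (volume : Measure ℝ).restrict (Ioc (scaleLower L j) (L ^ j / 2)))).measurable
  unfold Gam
  exact h

/-! ### `|Γ_j(x)| ≤ Γ_j(0) ≤ s⁻¹` -/

/-- `w(t,0;s) ≥ 0` (`s > 0`, `t > 0`). [folklore] -/
theorem wKer_zero_nonneg {s : ℝ} (hs : 0 < s) {t : ℝ} (ht : 0 < t) : 0 ≤ wKer d s t 0 :=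
  (abs_nonneg _).trans (abs_wKer_le_wKer_zero hs ht (0 : Site d))

/-- The lower end of the scale interval is nonnegative (`L ≥ 0`). [folklore] -/
theorem scaleLower_nonneg {L : ℝ} (hL : 0 ≤ L) (j : ℕ) : 0 ≤ scaleLower L j := by
  unfold scaleLower
  split_ifs
  · exact le_refl _
  · positivity

/-- `Γ_{j;0,0}(s) ≥ 0`. [folklore] -/
theorem Gam_zero_nonneg {L : ℝ} (hL : 0 ≤ L) {s : ℝ} (hs : 0 < s) (j : ℕ) :
    0 ≤ Gam d L s j (0 : Site d) := by
  unfold Gam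
  refine setIntegral_nonneg measurableSet_Ioc fun t ht => ?_
  have ht0 : 0 < t := lt_of_le_of_lt (scaleLower_nonneg hL j) ht.1
  exact div_nonneg (wKer_zero_nonneg hs ht0) ht0.le

/-- **`|Γ_{j;0,x}(s)| ≤ Γ_{j;0,0}(s)`** (from `|w(t,x)| ≤ w(t,0)`; equivalently from positive
semi-definiteness and translation invariance). [folklore] -/
theorem abs_Gam_le_Gam_zero {L : ℝ} (hL : 0 ≤ L) {s : ℝ} (hs : 0 < s) (j : ℕ) (x : Site d) :
    |Gam d L s j x| ≤ Gam d L s j 0 := by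
  unfold Gam
  have hlo := scaleLower_nonneg hL j
  calc |∫ t in Ioc (scaleLower L j) (L ^ j / 2), wKer d s t x / t|
      ≤ ∫ t in Ioc (scaleLower L j) (L ^ j / 2), |wKer d s t x / t| := abs_integral_le_integral_abs
    _ ≤ ∫ t in Ioc (scaleLower L j) (L ^ j / 2), wKer d s t 0 / t := by
        refine setIntegral_mono_on (integrableOn_wKer_div_Ioc hs x hlo).abs
          (integrableOn_wKer_div_Ioc hs 0 hlo) measurableSet_Ioc fun t ht => ?_
        have ht0 : 0 < t := lt_of_le_of_lt hlo ht.1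
        rw [abs_div, abs_of_pos ht0]
        exact div_le_div_of_nonneg_right (abs_wKer_le_wKer_zero hs ht0 x) ht0.le

/-- **`Γ_{j;0,0}(s) ≤ (-Δ+s)⁻¹_{0,0} ≤ s⁻¹`** for `j ≥ 1`, `L > 1`, `s > 0` (the terms of
`Σ_jΓ_j(0) = (-Δ+s)⁻¹_{0,0}` are nonnegative, and `(-Δ+s)⁻¹𝟙 = s⁻¹𝟙`).
[cite: Slade2017, §3.1 (first display) and §2.1.2 (display (2.14))] -/
theorem Gam_zero_le_inv (hd : 1 ≤ d) {L : ℝ} (hL : 1 < L) {s : ℝ} (hs : 0 < s) {j : ℕ}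
    (hj : 1 ≤ j) : Gam d L s j (0 : Site d) ≤ s⁻¹ := by
  have h := hasSum_Gam hL hs (0 : Site d)
  obtain ⟨m, rfl⟩ : ∃ m, j = m + 1 := ⟨j - 1, by omega⟩
  calc Gam d L s (m + 1) 0 ≤ resolventZd d s 0 0 :=
        le_hasSum h m fun k _ => Gam_zero_nonneg (zero_le_one.trans hL.le) hs (k + 1)
    _ ≤ 1 / s := resolventZd_le hd hs 0 0
    _ = s⁻¹ := one_div s

/-! ### Integrability of the Kato mixture integrands (`m² > 0`) -/

/-- `s⁻¹ρ^{(β)}(s,m²) ≤ cs^{β-1}/(s^β+m²)²` is integrable on `(0,∞)` for `m² > 0`, `β ∈ (0,1)`.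
[folklore] -/
theorem integrableOn_inv_mul_katoDensity {β : ℝ} (hβ0 : 0 < β) (hβ1 : β < 1) {m2 : ℝ}
    (hm2 : 0 < m2) :
    IntegrableOn (fun s : ℝ => s⁻¹ * Kato.katoDensity β m2 s) (Ioi 0) := by
  set cρ : ℝ := 2 * Real.sin (π * β) / (π * (1 + Real.cos (π * β))) with hcρ
  have hsin : 0 < Real.sin (π * β) := Real.sin_pos_of_pos_of_lt_pi (by positivity)
    (by nlinarith [Real.pi_pos])
  have hcos := Kato.one_add_cos_pos hβ0 hβ1
  have hcρ0 : 0 < cρ := by positivity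
  -- the majorant `cρ s^{β-1}/(s^β+m²)²` on `(0,1]` and `(1,∞)`
  have hg1 : IntegrableOn (fun s : ℝ => cρ * (s ^ (β - 1) / (s ^ β + m2) ^ 2)) (Ioc 0 1) := by
    refine (Integrable.const_mul ?_ cρ)
    refine CovBound.integrableOn_of_nonneg_of_le measurableSet_Ioc
      (CovBound.continuousOn_rpow_div_sq hm2.le fun _ hs => hs.1)
      ((CovBound.integrableOn_rpow_Ioc_zero (by linarith : -1 < β - 1) zero_le_one).const_mul
        (m2⁻¹ ^ 2)) fun s hs => ?_
    exact ⟨div_nonneg (Real.rpow_nonneg hs.1.le _) (sq_nonneg _),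
      CovBound.rpow_div_sq_le_inv_sq_mul hs.1 hm2⟩
  have hg2 : IntegrableOn (fun s : ℝ => cρ * (s ^ (β - 1) / (s ^ β + m2) ^ 2)) (Ioi 1) :=
    (CovBound.integrableOn_rpow_div_sq_Ioi (by linarith : β - 1 - 2 * β < -1) hm2.le
      zero_lt_one).const_mul cρ
  have hg : IntegrableOn (fun s : ℝ => cρ * (s ^ (β - 1) / (s ^ β + m2) ^ 2)) (Ioi 0) := by
    rw [← Ioc_union_Ioi_eq_Ioi zero_le_one]
    exact hg1.union hg2
  refine Integrable.mono' hg ((measurable_inv.mul (Kato.measurable_katoDensity β m2))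
    |>.aestronglyMeasurable) ((ae_restrict_iff' measurableSet_Ioi).2 (Eventually.of_forall
    fun s hs => ?_))
  have hs : (0 : ℝ) < s := hs
  have hρ := Kato.katoDensity_le_rpow_div_sq hβ0 hβ1 hm2.le hs
  have hρ0 := (Kato.katoDensity_pos hβ0 hβ1 m2 hs).le
  rw [Real.norm_eq_abs, abs_of_nonneg (mul_nonneg (inv_nonneg.2 hs.le) hρ0)]
  calc s⁻¹ * Kato.katoDensity β m2 s ≤ s⁻¹ * (cρ * (s ^ β / (s ^ β + m2) ^ 2)) :=
        mul_le_mul_of_nonneg_left hρ (inv_nonneg.2 hs.le)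
    _ = cρ * (s ^ (β - 1) / (s ^ β + m2) ^ 2) := by
        rw [Real.rpow_sub_one hs.ne']
        ring

/-- **The integrand of (3.8), `s ↦ Γ_{j;0,x}(s)ρ^{(β)}(s,m²)`, is integrable on `(0,∞)`**
(`d ≥ 1`, `L > 1`, `j ≥ 1`, `β ∈ (0,1)`, `m² > 0`): it is measurable and dominated by
`s⁻¹ρ(s,m²)`. [cite: Slade2017, §3.2 (display (3.8): "valid whenever we have a decomposition for strictly positive s > 0")] -/
theorem integrableOn_Gam_mul_katoDensity (hd : 1 ≤ d) {β : ℝ} (hβ0 : 0 < β) (hβ1 : β < 1)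
    {L : ℝ} (hL : 1 < L) {m2 : ℝ} (hm2 : 0 < m2) {j : ℕ} (hj : 1 ≤ j) (x : Site d) :
    IntegrableOn (fun s : ℝ => Gam d L s j x * Kato.katoDensity β m2 s) (Ioi 0) := by
  refine Integrable.mono' (integrableOn_inv_mul_katoDensity hβ0 hβ1 hm2)
    (((measurable_Gam L j x).mul (Kato.measurable_katoDensity β m2)).aestronglyMeasurable)
    ((ae_restrict_iff' measurableSet_Ioi).2 (Eventually.of_forall fun s hs => ?_))
  have hs : (0 : ℝ) < s := hs
  have hρ0 := (Kato.katoDensity_pos hβ0 hβ1 m2 hs).le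
  rw [Real.norm_eq_abs, abs_mul, abs_of_nonneg hρ0]
  exact mul_le_mul_of_nonneg_right (((abs_Gam_le_Gam_zero (zero_le_one.trans hL.le) hs j x).trans
    (Gam_zero_le_inv hd hL hs hj))) hρ0

/-! ### `Σ_j C_j = ((-Δ)^{α/2}+m²)⁻¹` on `ℤ^d` -/

/-- **Inserting `Γ = Σ_jΓ_j(s)` into the Kato mixture, PROVED**: for `d ≥ 1`, `α ∈ (0,2)`,
`m² > 0`, `L > 1` and every `x`,
`Σ_{j≥1} C_{j;0,x}(m²) = ∫₀^∞ (-Δ_{ℤ^d}+s)⁻¹_{x,0} ρ^{(α/2)}(s,m²) ds` (indexed by `m = j-1`),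
by dominated convergence with the dominating function `(-Δ+s)⁻¹_{0,0}ρ(s,m²) ≤ s⁻¹ρ(s,m²)`.
[cite: Slade2017, §3.2 (displays (3.6)–(3.8): "inserting (3.5) into (3.6)")] -/
theorem hasSum_fracCov (hd : 1 ≤ d) {α : ℝ} (hα0 : 0 < α) (hα2 : α < 2) {L : ℝ} (hL : 1 < L)
    {m2 : ℝ} (hm2 : 0 < m2) (x : Site d) :
    HasSum (fun m : ℕ => fracCov d L α m2 (m + 1) x)
      (∫ s in Ioi 0, resolventZd d s x 0 * Kato.katoDensity (α / 2) m2 s) := by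
  have hβ0 : 0 < α / 2 := by positivity
  have hβ1 : α / 2 < 1 := by linarith
  set μ : Measure ℝ := (volume : Measure ℝ).restrict (Ioi 0) with hμ
  have hae : ∀ {P : ℝ → Prop}, (∀ s : ℝ, 0 < s → P s) → ∀ᵐ s ∂μ, P s := fun h =>
    (ae_restrict_iff' measurableSet_Ioi).2 (Eventually.of_forall fun s hs => h s hs)
  have h := hasSum_integral_of_dominated_convergence (μ := μ)
    (F := fun (m : ℕ) (s : ℝ) => Gam d L s (m + 1) x * Kato.katoDensity (α / 2) m2 s)
    (f := fun s : ℝ => resolventZd d s x 0 * Kato.katoDensity (α / 2) m2 s)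
    (fun (m : ℕ) (s : ℝ) => Gam d L s (m + 1) 0 * Kato.katoDensity (α / 2) m2 s)
    (fun m => ((measurable_Gam L (m + 1) x).mul
      (Kato.measurable_katoDensity (α / 2) m2)).aestronglyMeasurable)
    (fun m => hae fun s hs => by
      have hρ0 := (Kato.katoDensity_pos hβ0 hβ1 m2 hs).le
      rw [Real.norm_eq_abs, abs_mul, abs_of_nonneg hρ0]
      exact mul_le_mul_of_nonneg_right (abs_Gam_le_Gam_zero (zero_le_one.trans hL.le) hs (m + 1) x) hρ0)
    (hae fun s hs => (hasSum_Gam hL hs (0 : Site d)).summable.mul_right _)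
    ?_
    (hae fun s hs => (hasSum_Gam hL hs x).mul_right _)
  · exact h
  -- the sum of the dominating functions is `(-Δ+s)⁻¹_{0,0}ρ(s) ≤ s⁻¹ρ(s)`
  have heq : (fun s : ℝ => ∑' m : ℕ, Gam d L s (m + 1) 0 * Kato.katoDensity (α / 2) m2 s) =ᵐ[μ]
      fun s => resolventZd d s 0 0 * Kato.katoDensity (α / 2) m2 s :=
    hae fun s hs => by
      show ∑' m : ℕ, Gam d L s (m + 1) 0 * Kato.katoDensity (α / 2) m2 s =
        resolventZd d s 0 0 * Kato.katoDensity (α / 2) m2 s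
      rw [tsum_mul_right, (hasSum_Gam hL hs (0 : Site d)).tsum_eq]
  refine Integrable.congr ?_ heq.symm
  refine Integrable.mono' (integrableOn_inv_mul_katoDensity hβ0 hβ1 hm2)
    (((measurable_resolventZd 0 0).mul (Kato.measurable_katoDensity (α / 2) m2)).aestronglyMeasurable)
    (hae fun s hs => ?_)
  have hρ0 := (Kato.katoDensity_pos hβ0 hβ1 m2 hs).le
  rw [Real.norm_eq_abs, abs_mul, abs_of_nonneg hρ0, abs_of_nonneg (resolventZd_nonneg hd hs 0 0)]
  refine mul_le_mul_of_nonneg_right ?_ hρ0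
  rw [← one_div]
  exact resolventZd_le hd hs 0 0

/-- **Slade, display (3.7) on `ℤ^d`, PROVED: `((-Δ_{ℤ^d})^{α/2}+m²)⁻¹_{x,0} = Σ_{j≥1} C_{j;0,x}(m²)`**
for `d ≥ 1`, `α ∈ (0,2)`, `m² > 0`, `L > 1` — the finite-range decomposition of the covariance
of the fractional Laplacian obtained "by inserting (3.5) into (3.6)" ([Mitt16]); with
Proposition 2.1.3 (`Slade2017_prop213_resolvent`) identifying the Kato mixture of the resolvents
with the inverse matrix `((-Δ)^{α/2}+m²)⁻¹` (`fracResolventZd`).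
[cite: Slade2017, §3.2 (display (3.7), the ℤ^d covariance; display (3.8))] -/
theorem Slade2017_display37_Zd (hd : 1 ≤ d) {α : ℝ} (hα0 : 0 < α) (hα2 : α < 2) {L : ℝ}
    (hL : 1 < L) {m2 : ℝ} (hm2 : 0 < m2) (x : Site d) :
    HasSum (fun m : ℕ => fracCov d L α m2 (m + 1) x) (fracResolventZd d (α / 2) m2 x 0) := by
  rw [Slade2017_prop213_resolvent hd (by positivity) (by linarith) hm2 x 0]
  exact hasSum_fracCov hd hα0 hα2 hL hm2 x

/-! ### Continuity of `C_j` in the mass -/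

/-- `s^{-β}/(2d+s)` is integrable on `(0,∞)` for `β ∈ (0,1)`, `d ≥ 1` (`≤ s^{-β}/(2d)` near `0`,
`≤ s^{-β-1}` at `∞`). [folklore] -/
theorem integrableOn_rpow_neg_div (hd : 1 ≤ d) {β : ℝ} (hβ0 : 0 < β) (hβ1 : β < 1) :
    IntegrableOn (fun s : ℝ => s ^ (-β) / (2 * d + s)) (Ioi 0) := by
  have hd' : (1 : ℝ) ≤ d := by exact_mod_cast hd
  have hcont : ∀ S : Set ℝ, S ⊆ Ioi 0 → ContinuousOn (fun s : ℝ => s ^ (-β) / (2 * d + s)) S := by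
    intro S hS s hs
    have hs0 : 0 < s := hS hs
    exact ((Real.continuousAt_rpow_const _ _ (Or.inl hs0.ne')).div
      (continuousAt_const.add continuousAt_id) (by
        show (2 * (d : ℝ)) + s ≠ 0
        linarith)).continuousWithinAt
  have h1 : IntegrableOn (fun s : ℝ => s ^ (-β) / (2 * d + s)) (Ioc 0 1) := by
    refine CovBound.integrableOn_of_nonneg_of_le measurableSet_Ioc (hcont _ fun s hs => hs.1)
      ((CovBound.integrableOn_rpow_Ioc_zero (by linarith : -1 < -β) zero_le_one).div_const (2 * d))
      fun s hs => ⟨div_nonneg (Real.rpow_nonneg hs.1.le _) (by linarith [hs.1]), ?_⟩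
    exact div_le_div_of_nonneg_left (Real.rpow_nonneg hs.1.le _) (by linarith) (by linarith [hs.1])
  have h2 : IntegrableOn (fun s : ℝ => s ^ (-β) / (2 * d + s)) (Ioi 1) := by
    refine CovBound.integrableOn_of_nonneg_of_le measurableSet_Ioi
      (hcont _ fun s hs => Set.mem_Ioi.2 (lt_trans zero_lt_one (Set.mem_Ioi.1 hs)))
      (integrableOn_Ioi_rpow_of_lt (by linarith : -β - 1 < -1) zero_lt_one) fun s hs => ?_
    have hs1 : (1 : ℝ) < s := hs
    have hs0 : 0 < s := by linarith
    refine ⟨div_nonneg (Real.rpow_nonneg hs0.le _) (by linarith), ?_⟩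
    calc s ^ (-β) / (2 * d + s) ≤ s ^ (-β) / s :=
          div_le_div_of_nonneg_left (Real.rpow_nonneg hs0.le _) hs0 (by linarith)
      _ = s ^ (-β - 1) := by rw [Real.rpow_sub_one hs0.ne']
  rw [← Ioc_union_Ioi_eq_Ioi zero_le_one]
  exact h1.union h2

/-- Kato's density is continuous in the mass parameter `a` (for `s > 0`, `β ∈ (0,1)`; a
rational function of `a` with positive denominator). [cite: Slade2017, §2.1.2 (display (2.15))] -/
theorem continuous_katoDensity_mass {β : ℝ} (hβ0 : 0 < β) (hβ1 : β < 1) {s : ℝ} (hs : 0 < s) :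
    Continuous fun a : ℝ => Kato.katoDensity β a s := by
  unfold Kato.katoDensity
  refine continuous_const.mul (continuous_const.div ?_ fun a => (Kato.katoDenom_pos hβ0 hβ1 a hs).ne')
  fun_prop

/-- **Slade, Proposition 3.3.1: "`C_{j;x,y}` is continuous in `m²`", PROVED** for the explicit
construction, for every `d ≥ 1`, `α ∈ (0,2)`, `L ≥ 2`, `j ≥ 1`, `x`: the map
`m² ↦ C_{j;0,x}(m²) = ∫₀^∞Γ_{j;0,x}(s)ρ^{(α/2)}(s,m²)ds` is continuous on all of `ℝ` (in
particular on `[0,m̄²]`, the printed range), by dominated convergence ("the continuity in `m²`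
… follows from (10.6)–(10.7) and the dominated convergence theorem", proof of Proposition 10.1.1)
with the dominating function `c(2d+s)⁻¹ · s^{-α/2}/(π sin(πα/2))` from the scaling estimate at
`p = 0` and the uniform bound `ρ(s,a) ≤ s^{-β}/(π sin πβ)`.
[cite: Slade2017, Proposition 3.3.1 ("C_{j;x,y} is continuous in m² ∈ [0,m̄²]")] [cite: Slade2017, §10.1 (proof of Proposition 10.1.1: "The continuity in m² claimed for C_{j;x,y} then follows from (10.6)–(10.7) and the dominated convergence theorem")] -/
theorem continuous_fracCov_mass (hd : 1 ≤ d) {α : ℝ} (hα0 : 0 < α) (hα2 : α < 2) {L : ℝ}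
    (hL : 2 ≤ L) {j : ℕ} (hj : 1 ≤ j) (x : Site d) :
    Continuous fun m2 : ℝ => fracCov d L α m2 j x := by
  have hβ0 : 0 < α / 2 := by positivity
  have hβ1 : α / 2 < 1 := by linarith
  have hL1 : (1 : ℝ) < L := by linarith
  obtain ⟨c, hc, hG⟩ := abs_Gam_le hd 0
  -- the `s`-independent prefactor of the scaling estimate at `p = 0`
  obtain ⟨Cj, hCj⟩ : ∃ Cj : ℝ, Cj = c * (∫ τ in Ioc (1 / 2 : ℝ) (L / 2), τ / τ ^ d) *
      ((L ^ (j - 1)) ^ 2 / (L ^ (j - 1)) ^ d) := ⟨_, rfl⟩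
  have hF0 : 0 ≤ ∫ τ in Ioc (1 / 2 : ℝ) (L / 2), τ / τ ^ d :=
    setIntegral_nonneg measurableSet_Ioc fun τ hτ => by
      have : (0 : ℝ) < τ := by linarith [hτ.1]
      positivity
  have hCj0 : 0 ≤ Cj := by
    rw [hCj]
    have : (0 : ℝ) ≤ L := by linarith
    positivity
  have hsin : 0 < Real.sin (π * (α / 2)) := Real.sin_pos_of_pos_of_lt_pi (by positivity)
    (by nlinarith [Real.pi_pos])
  set bound : ℝ → ℝ := fun s => Cj * (s ^ (-(α / 2)) / (2 * d + s)) / (π * Real.sin (π * (α / 2)))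
    with hbound
  have hGam : ∀ s : ℝ, 0 < s → |Gam d L s j x| ≤ Cj / (2 * d + s) := by
    intro s hs
    have h := hG L hL s hs j hj x
    simp only [pow_zero, inv_one, mul_one] at h
    calc |Gam d L s j x| ≤ c * (∫ τ in Ioc (1 / 2 : ℝ) (L / 2), τ / τ ^ d) * (1 / (2 * d + s)) *
          ((L ^ (j - 1)) ^ 2 / (L ^ (j - 1)) ^ d) := h
      _ = Cj / (2 * d + s) := by rw [hCj]; ring
  unfold fracCov
  refine continuous_of_dominated (μ := (volume : Measure ℝ).restrict (Ioi 0)) (bound := bound)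
    (fun m2 => ((measurable_Gam L j x).mul (Kato.measurable_katoDensity (α / 2) m2)).aestronglyMeasurable)
    (fun m2 => (ae_restrict_iff' measurableSet_Ioi).2 (Eventually.of_forall fun s hs => ?_)) ?_
    ((ae_restrict_iff' measurableSet_Ioi).2 (Eventually.of_forall fun s hs =>
      continuous_const.mul (continuous_katoDensity_mass hβ0 hβ1 hs)))
  · -- the domination
    have hs : (0 : ℝ) < s := hs
    have hd0 : (0 : ℝ) < 2 * d + s := by positivity
    have hρ0 := (Kato.katoDensity_pos hβ0 hβ1 m2 hs).le
    have hρ := (Kato.katoDensity_le hβ0 hβ1 m2 hs).1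
    rw [Real.norm_eq_abs, abs_mul, abs_of_nonneg hρ0, hbound]
    calc |Gam d L s j x| * Kato.katoDensity (α / 2) m2 s
        ≤ Cj / (2 * d + s) * (s ^ (-(α / 2)) / (π * Real.sin (π * (α / 2)))) :=
          mul_le_mul (hGam s hs) hρ (Kato.katoDensity_pos hβ0 hβ1 m2 hs).le (div_nonneg hCj0 hd0.le)
      _ = Cj * (s ^ (-(α / 2)) / (2 * d + s)) / (π * Real.sin (π * (α / 2))) := by ring
  · -- integrability of the bound
    have h := ((integrableOn_rpow_neg_div hd hβ0 hβ1).const_mul Cj).div_const (π * Real.sin (π * (α / 2)))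
    exact h

end FRD

end LongRangePhi4

end Literature.Barriers.CriticalPhenomena
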